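import Mathlib.Analysis.Subadditive
import Literature.Probability.LatticeModels.ImprovedTreeDiagramBoundProofs
import Literature.Probability.LatticeModels.SubcriticalFourier
import HarnessLib

/-!
# The directional inverse correlation length of the Ising two-point function

Topic `Probability/LatticeModels`. For the nearest-neighbour Ising model on `ℤ^d` with plus-state
two-point function `τ_β(x) = ⟨σ₀σ_x⟩⁺_{β,0}` (`twoPointPlus d β x`), the **directional inverse
correlation length** (directional mass) in the lattice direction `x ∈ ℤ^d` is

`dirInvCorrLength d β x = lim_{n → ∞} -(1/n) log ⟨σ₀ σ_{n x}⟩⁺_{β,0}`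

(Campanino–Ioffe–Velenik 2003, §1.1, eq. (1.1), there for `x ∈ ℝ^d` with the integer part `[kx]`;
Friedli–Velenik 2017, §3.10.11, p. 173, `ξ(β,h)(n)⁻¹`). `CorrelationDecay.lean` only has the axis
version `invCorrLength G = liminf -log |G(n e₁)| / n`; the present file supplies all lattice
directions, which is what the norm / Wulff-shape point of view needs (route
`CriticalPhenomena/TauBallRounding`, items `MonotoneRounding`, `RoundEndpoint`,
`RoundnessTransfer`, `RateExistsPositive`, whose signatures inline the `Tendsto` clause proved here
as `tendsto_dirInvCorrLength`).

## Contents (everything proved; no named fact is introduced)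

* Positivity of the two-point function for `β > 0` (missing from the tree so far):
  `gksSum_spinProduct_supp_pos` (one strictly positive term in the high-temperature expansion of a
  ferromagnetic `ν_{Λ;K}`), `isingCorr_pair_pos_of_adj` (finite volume, adjacent sites),
  `twoPointPlus_single_pos`, `twoPointPlus_pos` (`⟨σ₀σ_x⟩⁺_β > 0` for all `x`, `β > 0`, by GKS II
  along the coordinate axes).
* The definition `dirInvCorrLength` (a `liminf`, junk-free for `β > 0` by the next item) and
  Fekete's lemma: `tendsto_dirInvCorrLength` (the limit exists), `dirInvCorrLength_le_div`
  (`lim = inf`), the a-priori bound `twoPointPlus_zsmul_le_exp_neg` /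
  `twoPointPlus_le_exp_neg_dirInvCorrLength` (`⟨σ₀σ_x⟩⁺_β ≤ e^{-ξ_β(x)}`, CIV eq. (1.2)).
* The norm package on `ℤ^d`: `dirInvCorrLength_nonneg`, `_zero_right`, `_neg` (evenness),
  `_signedPerm` (lattice symmetries), `_natCast_zsmul` (positive homogeneity), `_add_le`
  (subadditivity, CIV "ξ_β is convex"), and the Messager–Miracle-Solé sandwich
  `‖x‖_∞ ξ_β(e₁) ≤ ξ_β(x) ≤ ‖x‖₁ ξ_β(e₁)`.
* Dependence on `β`: `dirInvCorrLength_anti` (antitone on `β > 0`, GKS), positivity for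
  `0 < β < β_c(d)` from the Aizenman–Barsky–Fernández sharpness theorem
  (`twoPoint_exponentialDecay_of_lt_criticalBeta_holds`, CIV Thm. 1.1 "⇐"), and vanishing at
  `β_c(d)` from the polynomial lower bound `criticalTwoPoint_lower` (CIV Thm. 1.1 "⇒" at `β_c`).
* `dirInvCorrLength_single_zero_one`: along `e₁` it is the tree's `invCorrLength (twoPointPlus d β)`.

## Design

* The value is a real `liminf`, exactly like `invCorrLength`; `Real.log 0 = 0` makes it junk when
  the two-point function vanishes (only at `β = 0`, where `dirInvCorrLength d 0 x = 0` although the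
  mass is `+∞`), and for `β < 0` nothing is claimed. All theorems carry `0 < β` (or `0 ≤ β` plus
  positivity of `⟨σ₀σ_x⟩⁺_β` in the direction at hand).
* The printed definitions take a direction in `ℝ^d` (integer parts `[kx]`); for `x ∈ ℤ^d` this is
  the sequence `k x` used here. The extension to a (semi)norm on `ℝ^d` is not formalised.
* Imports: GKS II along a path for the plus state (`twoPointPlus_mul_le_twoPointPlus`,
  `pow_le_twoPointPlus_single`) lives in `ImprovedTreeDiagramBoundProofs`; evenness
  (`twoPointPlus_neg`), the sharpness discharge and `plus = free` below `β_c` are reachable from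
  `SubcriticalFourier`; hence the two project imports.

## References

* M. Campanino, D. Ioffe, Y. Velenik, *Ornstein–Zernike theory for finite range Ising models
  above `T_c`*, Probab. Theory Relat. Fields 125 (2003) 305–349, §1.1 (eq. (1.1), (1.2),
  Thm. 1.1). [CampaninoIoffeVelenik2003]
* S. Friedli, Y. Velenik, *Statistical Mechanics of Lattice Systems* (CUP 2017), §3.10.11,
  p. 173 (directional correlation length); Thm. 3.20 (GKS); Thm. 3.49 and eq. (3.56)
  (ferromagnetic `ν_{Λ;K}`). [FriedliVelenik2017]
* M. Aizenman, D. Barsky, R. Fernández, J. Stat. Phys. 47 (1987) 343–374, Thm. 1 (sharpness).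

## Mathlib

`Subadditive.tendsto_lim`, `Subadditive.lim_le_div` (Fekete), `Filter.Tendsto.liminf_eq`,
`pi_norm_le_iff_of_nonneg`, `norm_le_pi_norm`, `Finset.univ_sum_single`.
-/

noncomputable section

open Filter Topology Finset

namespace Literature.Probability.LatticeModels

/-! ### Part 0. Strict positivity of ferromagnetic pair correlations -/

section GKSPos

variable {Λ ι : Type*} [Fintype Λ] [DecidableEq Λ] (s : Finset ι) (K : ι → ℝ) (C : ι → Finset Λ)

/-- **One strictly positive term in the high-temperature expansion.** For a ferromagnetic system
`ν_{Λ;K} ∝ exp(∑ᵢ Kᵢ ω_{Cᵢ})`, `Kᵢ ≥ 0`, and an interaction index `i₀` with `K_{i₀} > 0`, the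
unnormalised expectation of its own spin product is positive:
`Z_{Λ;K} ⟨ω_{C_{i₀}}⟩_{Λ;K} ≥ sinh K_{i₀} ∏_{i ≠ i₀} cosh Kᵢ · 2^{|Λ|} > 0`. In the expansion
`e^{∑ Kᵢω_{Cᵢ}} = ∑_{S ⊆ s} ∏_{i∈S} sinh Kᵢ ∏_{i∉S} cosh Kᵢ ∏_{i∈S} ω_{Cᵢ}` (Friedli–Velenik 2017,
proof of Thm. 3.49 via eq. (3.56), p. 142, `gksWeight_eq_sum_powerset`) every term has nonnegative
`ω`-sum (first GKS inequality) and the term `S = {i₀}` contributes `∑_ω ω_{C_{i₀}}² = 2^{|Λ|}`. [cite: FriedliVelenik2017, proof of Thm. 3.49, eq. (3.56), p. 142] -/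
theorem gksSum_spinProduct_supp_pos [DecidableEq ι] (hK : ∀ i ∈ s, 0 ≤ K i) {i₀ : ι}
    (hi₀ : i₀ ∈ s) (h0 : 0 < K i₀) : 0 < gksSum s K C (spinProduct (C i₀)) := by
  simp only [gksSum, gksWeight_eq_sum_powerset s K C, Finset.mul_sum]
  rw [Finset.sum_comm]
  -- every term of the expansion is nonnegative (as in `gksSum_spinProduct_nonneg`)
  have hterm : ∀ S ∈ s.powerset, 0 ≤ ∑ ω : SpinConfig Λ, spinProduct (C i₀) ω *
      (((∏ i ∈ S, Real.sinh (K i)) * ∏ i ∈ s \ S, Real.cosh (K i)) *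
        ∏ i ∈ S, spinProduct (C i) ω) := by
    intro S hS
    have hSs : S ⊆ s := Finset.mem_powerset.1 hS
    have hcoef : 0 ≤ (∏ i ∈ S, Real.sinh (K i)) * ∏ i ∈ s \ S, Real.cosh (K i) :=
      mul_nonneg (Finset.prod_nonneg fun i hi => Real.sinh_nonneg_iff.2 (hK i (hSs hi)))
        (Finset.prod_nonneg fun i _ => (Real.cosh_pos _).le)
    have hre : ∑ ω : SpinConfig Λ, spinProduct (C i₀) ω *
        (((∏ i ∈ S, Real.sinh (K i)) * ∏ i ∈ s \ S, Real.cosh (K i)) *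
          ∏ i ∈ S, spinProduct (C i) ω) =
        ((∏ i ∈ S, Real.sinh (K i)) * ∏ i ∈ s \ S, Real.cosh (K i)) *
          ∑ ω : SpinConfig Λ, spinProduct (C i₀) ω * ∏ i ∈ S, spinProduct (C i) ω := by
      rw [Finset.mul_sum]
      exact Finset.sum_congr rfl fun ω _ => by ring
    rw [hre]
    refine mul_nonneg hcoef ?_
    simp_rw [spinProduct_mul_prod_eq_prod_pow C (C i₀) S]
    exact sum_prod_spinAt_pow_nonneg _
  refine lt_of_lt_of_le ?_ (Finset.single_le_sum hterm
    (Finset.mem_powerset.2 (Finset.singleton_subset_iff.2 hi₀)))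
  -- the term `S = {i₀}`
  have hcoef0 : 0 < Real.sinh (K i₀) * ∏ i ∈ s \ {i₀}, Real.cosh (K i) :=
    mul_pos (Real.sinh_pos_iff.2 h0) (Finset.prod_pos fun i _ => Real.cosh_pos _)
  have hsum : ∑ ω : SpinConfig Λ, spinProduct (C i₀) ω *
      (((∏ i ∈ ({i₀} : Finset ι), Real.sinh (K i)) * ∏ i ∈ s \ {i₀}, Real.cosh (K i)) *
        ∏ i ∈ ({i₀} : Finset ι), spinProduct (C i) ω) =
      (Fintype.card (SpinConfig Λ) : ℝ) * (Real.sinh (K i₀) * ∏ i ∈ s \ {i₀}, Real.cosh (K i)) := by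
    simp only [Finset.prod_singleton]
    have hω : ∀ ω : SpinConfig Λ, spinProduct (C i₀) ω *
        ((Real.sinh (K i₀) * ∏ i ∈ s \ {i₀}, Real.cosh (K i)) * spinProduct (C i₀) ω) =
        Real.sinh (K i₀) * ∏ i ∈ s \ {i₀}, Real.cosh (K i) := by
      intro ω
      have h1 := spinProduct_mul_self (C i₀) ω
      calc spinProduct (C i₀) ω *
            ((Real.sinh (K i₀) * ∏ i ∈ s \ {i₀}, Real.cosh (K i)) * spinProduct (C i₀) ω)
          = (Real.sinh (K i₀) * ∏ i ∈ s \ {i₀}, Real.cosh (K i)) *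
              (spinProduct (C i₀) ω * spinProduct (C i₀) ω) := by ring
        _ = Real.sinh (K i₀) * ∏ i ∈ s \ {i₀}, Real.cosh (K i) := by rw [h1, mul_one]
    simp_rw [hω]
    rw [Finset.sum_const, Finset.card_univ, nsmul_eq_mul]
  rw [hsum]
  exact mul_pos (by exact_mod_cast Fintype.card_pos) hcoef0

/-- Normalised form: `⟨ω_{C_{i₀}}⟩_{Λ;K} > 0` when all `Kᵢ ≥ 0` and `K_{i₀} > 0`. [cite: FriedliVelenik2017, proof of Thm. 3.49, eq. (3.56), p. 142] -/
theorem gksExpect_spinProduct_supp_pos [DecidableEq ι] (hK : ∀ i ∈ s, 0 ≤ K i) {i₀ : ι}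
    (hi₀ : i₀ ∈ s) (h0 : 0 < K i₀) : 0 < gksExpect s K C (spinProduct (C i₀)) :=
  div_pos (gksSum_spinProduct_supp_pos s K C hK hi₀ h0) (gksSum_one_pos s K C)

end GKSPos

section IsingPos

variable {V : Type*} [DecidableEq V] (G : SimpleGraph V) [G.LocallyFinite]

/-- **Nearest-neighbour correlations are positive at `β > 0`.** For the Ising model in a finite
volume `Λ` of a locally finite graph with free or `+` boundary condition, `β > 0`, `h ≥ 0`, and
adjacent sites `x ∼ y` in `Λ`: `⟨σ_xσ_y⟩^{bc}_{Λ;β,h} > 0` (the edge `{x,y}` is an interaction term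
with coupling `β > 0` in the representation `ν_{Λ;K}` of Friedli–Velenik 2017, §3.8.1, p. 141;
apply `gksExpect_spinProduct_supp_pos`). [cite: FriedliVelenik2017, §3.8.1, p. 141, and proof of Thm. 3.49, p. 142] -/
theorem isingCorr_pair_pos_of_adj {Λ : Finset V} {x y : V} (hadj : G.Adj x y) (hx : x ∈ Λ)
    (hy : y ∈ Λ) {β h : ℝ} (hβ : 0 < β) (hh : 0 ≤ h) {bc : BoundaryCondition V}
    (hbc : bc = .free ∨ bc = .plus) : 0 < isingCorr G Λ β h bc {x, y} := by
  classical
  have hA : ({x, y} : Finset V) ⊆ Λ := by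
    intro z hz
    simp only [Finset.mem_insert, Finset.mem_singleton] at hz
    rcases hz with rfl | rfl
    · exact hx
    · exact hy
  rw [isingCorr_eq_gksExpect G Λ β h bc hA]
  have he : s(x, y) ∈ G.edgeSet := by rwa [SimpleGraph.mem_edgeSet]
  have hidx : (Sum.inl s(x, y) : Sym2 V ⊕ V) ∈ isingIdx G Λ := by
    rw [isingIdx, Finset.inl_mem_disjSum, mem_edgesTouching_iff]
    exact ⟨he, x, hx, Sym2.mem_mk_left x y⟩
  have hin : s(x, y) ∈ edgesIn G Λ := by
    rw [mem_edgesIn_iff]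
    refine ⟨he, fun z hz => ?_⟩
    rcases Sym2.mem_iff.1 hz with rfl | rfl
    · exact hx
    · exact hy
  have hint : s(x, y) ∈ interactionEdges G Λ bc := by
    rcases hbc with rfl | rfl
    · rwa [interactionEdges_free]
    · simp only [BoundaryCondition.plus, interactionEdges_fixed]
      exact edgesIn_subset_edgesTouching Λ hin
  have hK : gksCoupling G Λ β h bc (Sum.inl s(x, y)) = β := by
    simp only [gksCoupling, hint, if_true]
    rw [edgeCoeff_of_mem_edgesIn G bc hin, mul_one]
  have hsupp : inVol Λ {x, y} = isingSupp Λ (Sum.inl s(x, y)) := by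
    ext z
    simp [isingSupp, Sym2.mem_iff]
  rw [hsupp]
  exact gksExpect_spinProduct_supp_pos _ _ _ (gksCoupling_nonneg G hβ.le hh hbc) hidx
    (by rw [hK]; exact hβ)

end IsingPos

section PlusStatePos

variable {d : ℕ} {β : ℝ}

/-- **`⟨σ₀σ_{eᵢ}⟩⁺_β > 0` for `β > 0`**: the plus state dominates the free state, which dominates
the free box states (GKS; Friedli–Velenik 2017, Exercises 3.12 and 3.25), and in the box `Λ₁ ∋ 0,
eᵢ` the nearest-neighbour correlation is positive (`isingCorr_pair_pos_of_adj`). [cite: FriedliVelenik2017, Exercise 3.25 and Thm. 3.20, p. 109] -/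
theorem twoPointPlus_single_pos (hβ : 0 < β) (i : Fin d) :
    0 < twoPointPlus d β (Pi.single i 1) := by
  have hne : (Pi.single i (1 : ℤ) : Site d) ≠ 0 := fun h => by simpa using congrFun h i
  have hadj : (zdGraph d).Adj 0 (Pi.single i 1) :=
    (zdGraph_adj_iff _ _).2 ⟨i, Or.inl (by rw [zero_add])⟩
  have hmem : (Pi.single i (1 : ℤ) : Site d) ∈ box d 1 := by
    rw [mem_box]
    intro j
    by_cases hj : j = i
    · subst hj; simp
    · simp [Pi.single_eq_of_ne hj]
  have hbox : ({0, Pi.single i 1} : Finset (Site d)) ⊆ box d 1 := by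
    intro z hz
    simp only [Finset.mem_insert, Finset.mem_singleton] at hz
    rcases hz with rfl | rfl
    · exact zero_mem_box d 1
    · exact hmem
  calc (0 : ℝ) < isingCorr (zdGraph d) (box d 1) β 0 .free {0, Pi.single i 1} :=
        isingCorr_pair_pos_of_adj (zdGraph d) hadj (zero_mem_box d 1) hmem hβ le_rfl (Or.inl rfl)
    _ ≤ freeCorr d β 0 {0, Pi.single i 1} := isingCorr_free_box_le_freeCorr hβ.le le_rfl hbox
    _ ≤ plusCorr d β 0 {0, Pi.single i 1} := freeCorr_le_plusCorr hβ.le le_rfl _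
    _ = twoPointPlus d β (Pi.single i 1) := (twoPointPlus_eq_plusCorr β hne).symm

/-- GKS II in additive form: `⟨σ₀σ_a⟩⁺ ⟨σ₀σ_b⟩⁺ ≤ ⟨σ₀σ_{a+b}⟩⁺` for `β ≥ 0`
(`twoPointPlus_mul_le_twoPointPlus` with `y = a + b`; Friedli–Velenik 2017, Thm. 3.20, eq. (3.22)). [cite: FriedliVelenik2017, Thm. 3.20, eq. (3.22), p. 109] -/
theorem twoPointPlus_mul_le_twoPointPlus_add (hβ : 0 ≤ β) (a b : Site d) :
    twoPointPlus d β a * twoPointPlus d β b ≤ twoPointPlus d β (a + b) := by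
  have h := twoPointPlus_mul_le_twoPointPlus hβ a (a + b)
  rwa [add_sub_cancel_left] at h

/-- Supermultiplicativity along any lattice direction: `⟨σ₀σ_x⟩⁺_β ^ n ≤ ⟨σ₀σ_{nx}⟩⁺_β` for
`β ≥ 0` (iterate GKS II; Campanino–Ioffe–Velenik 2003, §1.1, "a standard sub-additivity argument
based on Griffiths' second inequality"). [cite: CampaninoIoffeVelenik2003, §1.1, eq. (1.1)–(1.2)] -/
theorem pow_le_twoPointPlus_zsmul (hβ : 0 ≤ β) (x : Site d) (n : ℕ) :
    twoPointPlus d β x ^ n ≤ twoPointPlus d β ((n : ℤ) • x) := by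
  induction n with
  | zero => simp [twoPointPlus_zero]
  | succ n ih =>
    have h := twoPointPlus_mul_le_twoPointPlus_add hβ ((n : ℤ) • x) x
    have hx : ((n : ℤ) • x + x : Site d) = ((n + 1 : ℕ) : ℤ) • x := by
      push_cast
      rw [add_zsmul, one_zsmul]
    rw [hx] at h
    calc twoPointPlus d β x ^ (n + 1) = twoPointPlus d β x ^ n * twoPointPlus d β x := pow_succ _ _
      _ ≤ twoPointPlus d β ((n : ℤ) • x) * twoPointPlus d β x :=
          mul_le_mul_of_nonneg_right ih (twoPointPlus_nonneg_of_gks hβ _)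
      _ ≤ twoPointPlus d β (((n + 1 : ℕ) : ℤ) • x) := h

/-- **`⟨σ₀σ_x⟩⁺_β > 0` for every `x ∈ ℤ^d` and `β > 0`** (GKS II along the coordinate axes:
`⟨σ₀σ_{me_i}⟩⁺ ≥ ⟨σ₀σ_{e_i}⟩⁺^{|m|} > 0` by `pow_le_twoPointPlus_single`, evenness and
`twoPointPlus_single_pos`, then `⟨σ₀σ_{a+b}⟩⁺ ≥ ⟨σ₀σ_a⟩⁺⟨σ₀σ_b⟩⁺` over `x = ∑ᵢ xᵢ eᵢ`; the
positivity input "`⟨σ₀σ_y⟩⁺_β > 0`" of Campanino–Ioffe–Velenik 2003, §1.1). [cite: FriedliVelenik2017, Thm. 3.20, eq. (3.22), p. 109] [cite: CampaninoIoffeVelenik2003, §1.1] -/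
theorem twoPointPlus_pos (hβ : 0 < β) (x : Site d) : 0 < twoPointPlus d β x := by
  have haxis : ∀ (i : Fin d) (m : ℤ), 0 < twoPointPlus d β (Pi.single i m) := by
    intro i m
    have hnat : ∀ n : ℕ, 0 < twoPointPlus d β (Pi.single i (n : ℤ)) := fun n =>
      lt_of_lt_of_le (pow_pos (twoPointPlus_single_pos hβ i) n)
        (pow_le_twoPointPlus_single hβ.le i n)
    obtain ⟨n, rfl | rfl⟩ := Int.eq_nat_or_neg m
    · exact hnat n
    · rw [Pi.single_neg, twoPointPlus_neg]
      exact hnat n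
  have key : ∀ s : Finset (Fin d), 0 < twoPointPlus d β (∑ i ∈ s, Pi.single i (x i)) := by
    intro s
    refine Finset.induction_on s ?_ ?_
    · rw [Finset.sum_empty, twoPointPlus_zero]
      exact one_pos
    · intro j s hj ih
      rw [Finset.sum_insert hj]
      exact lt_of_lt_of_le (mul_pos (haxis j (x j)) ih)
        (twoPointPlus_mul_le_twoPointPlus_add hβ.le _ _)
  have h := key Finset.univ
  rwa [Finset.univ_sum_single x] at h

/-- Hence `⟨σ₀σ_{nx}⟩⁺_β > 0` along every direction (`β > 0`). [cite: CampaninoIoffeVelenik2003, §1.1] -/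
theorem twoPointPlus_zsmul_pos (hβ : 0 < β) (x : Site d) (n : ℕ) :
    0 < twoPointPlus d β ((n : ℤ) • x) :=
  twoPointPlus_pos hβ _

/-- Monotonicity in `β` of the two-point function: `⟨σ₀σ_x⟩⁺_β ≤ ⟨σ₀σ_x⟩⁺_{β'}` for
`0 ≤ β ≤ β'` (GKS II; Friedli–Velenik 2017, Exercise 3.9 / Lemma 3.31 in the limit,
`plusCorr_mono_params`). [cite: FriedliVelenik2017, Lemma 3.31, p. 119] -/
theorem twoPointPlus_le_twoPointPlus_of_le (hβ : 0 ≤ β) {β' : ℝ} (hββ' : β ≤ β') (x : Site d) :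
    twoPointPlus d β x ≤ twoPointPlus d β' x := by
  by_cases hx : x = 0
  · subst hx
    rw [twoPointPlus_zero, twoPointPlus_zero]
  · rw [twoPointPlus_eq_plusCorr β hx, twoPointPlus_eq_plusCorr β' hx]
    exact plusCorr_mono_params hβ hββ' le_rfl le_rfl _

/-- The sup norm scales: `‖n x‖_∞ = n ‖x‖_∞` for `n ∈ ℕ`, `x ∈ ℤ^d` (Pi sup norm). [folklore] -/
theorem Site.norm_natCast_zsmul (n : ℕ) (x : Site d) : ‖((n : ℤ) • x : Site d)‖ = n * ‖x‖ := by
  have hcoord : ∀ i, ‖((n : ℤ) • x) i‖ = n * ‖x i‖ := fun i => by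
    rw [Pi.smul_apply, smul_eq_mul, Int.norm_eq_abs, Int.norm_eq_abs]
    push_cast
    rw [abs_mul, Nat.abs_cast]
  apply le_antisymm
  · refine (pi_norm_le_iff_of_nonneg (by positivity)).2 fun i => ?_
    rw [hcoord]
    exact mul_le_mul_of_nonneg_left (norm_le_pi_norm x i) n.cast_nonneg
  · rcases Nat.eq_zero_or_pos n with rfl | hn
    · simp
    · have hn' : (0 : ℝ) < n := by exact_mod_cast hn
      have : ‖x‖ ≤ ‖((n : ℤ) • x : Site d)‖ / n :=
        (pi_norm_le_iff_of_nonneg (by positivity)).2 fun i => by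
          rw [le_div_iff₀ hn', mul_comm, ← hcoord]
          exact norm_le_pi_norm _ i
      rwa [le_div_iff₀ hn', mul_comm] at this

end PlusStatePos

/-! ### Part 1. The definition and Fekete's lemma -/

section Defn

variable {d : ℕ} {β : ℝ}

variable (d) in
/-- **The directional inverse correlation length** (directional mass) of the plus-state Ising
two-point function on `ℤ^d` in the lattice direction `x`:
`ξ_β(x) = lim_{n → ∞} -(1/n) log ⟨σ₀ σ_{n x}⟩⁺_{β,0}`, formalised as the `liminf` of the sequence
(which is its limit for `β > 0`, `tendsto_dirInvCorrLength`, and its infimum over `n ≥ 1`,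
`dirInvCorrLength_le_div`). Campanino–Ioffe–Velenik 2003, §1.1, eq. (1.1) (`ξ_β(x)`, stated for
`x ∈ ℝ^d` with integer parts `[kx]`; for `x ∈ ℤ^d`, `[kx] = kx`); Friedli–Velenik 2017, §3.10.11,
p. 173 (`ξ(β,h)(n)`, the correlation length in direction `n`, whose inverse this is at `h = 0`).
Junk: `Real.log 0 = 0`, so at `β = 0` (where `⟨σ₀σ_{nx}⟩⁺ = 0` for `nx ≠ 0`) the value is `0`,
not `+∞`; for `β < 0` the value is meaningless. Along `e₁` this is
`invCorrLength (twoPointPlus d β)` (`dirInvCorrLength_single_zero_one`). [cite: CampaninoIoffeVelenik2003, §1.1, eq. (1.1)] [cite: FriedliVelenik2017, §3.10.11, p. 173] -/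
def dirInvCorrLength (β : ℝ) (x : Site d) : ℝ :=
  liminf (fun n : ℕ => -Real.log (twoPointPlus d β ((n : ℤ) • x)) / (n : ℝ)) atTop

/-- Unfolding lemma. [cite: CampaninoIoffeVelenik2003, §1.1, eq. (1.1)] -/
theorem dirInvCorrLength_def (β : ℝ) (x : Site d) :
    dirInvCorrLength d β x =
      liminf (fun n : ℕ => -Real.log (twoPointPlus d β ((n : ℤ) • x)) / (n : ℝ)) atTop := rfl

/-- The sequence `u_n = -log ⟨σ₀σ_{nx}⟩⁺_β` is subadditive when the two-point function is positive
along the direction (GKS II: `⟨σ₀σ_{mx}⟩⁺⟨σ₀σ_{nx}⟩⁺ ≤ ⟨σ₀σ_{(m+n)x}⟩⁺`; Campanino–Ioffe–Velenik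
2003, §1.1). [cite: CampaninoIoffeVelenik2003, §1.1, eq. (1.1)–(1.2)] -/
theorem subadditive_neg_log_twoPointPlus_zsmul (hβ : 0 ≤ β) {x : Site d}
    (hpos : ∀ n : ℕ, 0 < twoPointPlus d β ((n : ℤ) • x)) :
    Subadditive fun n : ℕ => -Real.log (twoPointPlus d β ((n : ℤ) • x)) := by
  intro m n
  have h := twoPointPlus_mul_le_twoPointPlus_add hβ ((m : ℤ) • x) ((n : ℤ) • x)
  have hmn : ((m : ℤ) • x + (n : ℤ) • x : Site d) = ((m + n : ℕ) : ℤ) • x := by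
    push_cast
    rw [add_zsmul]
  rw [hmn] at h
  have hlog := Real.log_le_log (mul_pos (hpos m) (hpos n)) h
  rw [Real.log_mul (hpos m).ne' (hpos n).ne'] at hlog
  dsimp only
  linarith

/-- Positivity along a direction propagates from the first step (`β ≥ 0`):
`⟨σ₀σ_{nx}⟩⁺ ≥ ⟨σ₀σ_x⟩⁺^n > 0`. [cite: CampaninoIoffeVelenik2003, §1.1] -/
theorem twoPointPlus_zsmul_pos_of_pos (hβ : 0 ≤ β) {x : Site d} (hx : 0 < twoPointPlus d β x)
    (n : ℕ) : 0 < twoPointPlus d β ((n : ℤ) • x) :=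
  lt_of_lt_of_le (pow_pos hx n) (pow_le_twoPointPlus_zsmul hβ x n)

/-- The terms `-log ⟨σ₀σ_{nx}⟩⁺_β / n` are nonnegative for `β ≥ 0` (`0 ≤ ⟨σ₀σ_y⟩⁺ ≤ 1`, and
`Real.log 0 = 0`). [cite: FriedliVelenik2017, Thm. 3.20, p. 109] -/
theorem neg_log_twoPointPlus_zsmul_div_nonneg (hβ : 0 ≤ β) (x : Site d) (n : ℕ) :
    0 ≤ -Real.log (twoPointPlus d β ((n : ℤ) • x)) / (n : ℝ) := by
  refine div_nonneg ?_ (Nat.cast_nonneg n)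
  rw [neg_nonneg]
  exact Real.log_nonpos (twoPointPlus_nonneg_of_gks hβ _) (twoPointPlus_le_one_of_nonneg hβ _)

/-- With positivity in the direction, the terms are bounded above by the first one times `1`:
`-log ⟨σ₀σ_{nx}⟩⁺/n ≤ -log ⟨σ₀σ_x⟩⁺` (from `⟨σ₀σ_{nx}⟩⁺ ≥ ⟨σ₀σ_x⟩⁺^n`). [cite: CampaninoIoffeVelenik2003, §1.1, eq. (1.2)] -/
theorem neg_log_twoPointPlus_zsmul_div_le (hβ : 0 ≤ β) {x : Site d} (hx : 0 < twoPointPlus d β x)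
    (n : ℕ) : -Real.log (twoPointPlus d β ((n : ℤ) • x)) / (n : ℝ) ≤ -Real.log (twoPointPlus d β x) := by
  rcases Nat.eq_zero_or_pos n with rfl | hn
  · simp only [Nat.cast_zero, div_zero, neg_nonneg]
    exact Real.log_nonpos hx.le (twoPointPlus_le_one_of_nonneg hβ _)
  · have hn' : (0 : ℝ) < n := by exact_mod_cast hn
    rw [div_le_iff₀ hn']
    have h := Real.log_le_log (pow_pos hx n) (pow_le_twoPointPlus_zsmul hβ x n)
    rw [Real.log_pow] at h
    linarith

/-- **Fekete: the directional inverse correlation length is a limit.** For `β ≥ 0` and a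
direction `x` with `⟨σ₀σ_x⟩⁺_β > 0`, `-log ⟨σ₀σ_{nx}⟩⁺_β / n → ξ_β(x)` (Campanino–Ioffe–Velenik
2003, §1.1: "A standard sub-additivity argument based on Griffiths' second inequality implies
that this limit is well-defined"; Mathlib's `Subadditive.tendsto_lim`). [cite: CampaninoIoffeVelenik2003, §1.1, eq. (1.1)] -/
theorem tendsto_dirInvCorrLength_of_pos (hβ : 0 ≤ β) {x : Site d} (hx : 0 < twoPointPlus d β x) :
    Tendsto (fun n : ℕ => -Real.log (twoPointPlus d β ((n : ℤ) • x)) / (n : ℝ)) atTop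
      (𝓝 (dirInvCorrLength d β x)) := by
  have hsub := subadditive_neg_log_twoPointPlus_zsmul hβ (twoPointPlus_zsmul_pos_of_pos hβ hx)
  have hbdd : BddBelow (Set.range fun n : ℕ => -Real.log (twoPointPlus d β ((n : ℤ) • x)) / (n : ℝ)) :=
    ⟨0, by rintro _ ⟨n, rfl⟩; exact neg_log_twoPointPlus_zsmul_div_nonneg hβ x n⟩
  have htend := hsub.tendsto_lim hbdd
  have heq : dirInvCorrLength d β x = hsub.lim := htend.liminf_eq
  rw [heq]
  exact htend

/-- **Fekete, `lim = inf`**: `ξ_β(x) ≤ -log ⟨σ₀σ_{nx}⟩⁺_β / n` for every `n ≥ 1` (`β ≥ 0`,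
`⟨σ₀σ_x⟩⁺_β > 0`; Mathlib's `Subadditive.lim_le_div`). [cite: CampaninoIoffeVelenik2003, §1.1, eq. (1.2)] -/
theorem dirInvCorrLength_le_div_of_pos (hβ : 0 ≤ β) {x : Site d} (hx : 0 < twoPointPlus d β x)
    {n : ℕ} (hn : n ≠ 0) :
    dirInvCorrLength d β x ≤ -Real.log (twoPointPlus d β ((n : ℤ) • x)) / (n : ℝ) := by
  have hsub := subadditive_neg_log_twoPointPlus_zsmul hβ (twoPointPlus_zsmul_pos_of_pos hβ hx)
  have hbdd : BddBelow (Set.range fun n : ℕ => -Real.log (twoPointPlus d β ((n : ℤ) • x)) / (n : ℝ)) :=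
    ⟨0, by rintro _ ⟨n, rfl⟩; exact neg_log_twoPointPlus_zsmul_div_nonneg hβ x n⟩
  have heq : dirInvCorrLength d β x = hsub.lim := (hsub.tendsto_lim hbdd).liminf_eq
  rw [heq]
  exact hsub.lim_le_div hbdd hn

/-- **The a-priori bound `⟨σ₀σ_{nx}⟩⁺_β ≤ e^{-n ξ_β(x)}`** for all `n` (`β ≥ 0`,
`⟨σ₀σ_x⟩⁺_β > 0`): Campanino–Ioffe–Velenik 2003, §1.1, eq. (1.2),
`g_β(x) ≤ e^{-ξ_β(x)} = e^{-ξ_β(n⃗(x))|x|}`. [cite: CampaninoIoffeVelenik2003, §1.1, eq. (1.2)] -/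
theorem twoPointPlus_zsmul_le_exp_neg_of_pos (hβ : 0 ≤ β) {x : Site d}
    (hx : 0 < twoPointPlus d β x) (n : ℕ) :
    twoPointPlus d β ((n : ℤ) • x) ≤ Real.exp (-((n : ℝ) * dirInvCorrLength d β x)) := by
  rcases Nat.eq_zero_or_pos n with rfl | hn
  · simp [twoPointPlus_zero]
  · have hn' : (0 : ℝ) < n := by exact_mod_cast hn
    have h := dirInvCorrLength_le_div_of_pos hβ hx (n := n) (by omega)
    rw [le_div_iff₀ hn'] at h
    rw [← Real.log_le_iff_le_exp (twoPointPlus_zsmul_pos_of_pos hβ hx n)]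
    linarith

end Defn

/-! ### Part 2. The norm package on `ℤ^d` (for `β > 0`) -/

section NormPackage

variable {d : ℕ} {β : ℝ}

/-- **Existence of the directional inverse correlation length** (`β > 0`, every direction):
`-log ⟨σ₀σ_{nx}⟩⁺_β / n → ξ_β(x)`; this is the `Tendsto` clause inlined in the items of route
`CriticalPhenomena/TauBallRounding` (Campanino–Ioffe–Velenik 2003, §1.1, eq. (1.1): Fekete from
GKS II, positivity from `twoPointPlus_pos`). [cite: CampaninoIoffeVelenik2003, §1.1, eq. (1.1)] -/
theorem tendsto_dirInvCorrLength (hβ : 0 < β) (x : Site d) :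
    Tendsto (fun n : ℕ => -Real.log (twoPointPlus d β ((n : ℤ) • x)) / (n : ℝ)) atTop
      (𝓝 (dirInvCorrLength d β x)) :=
  tendsto_dirInvCorrLength_of_pos hβ.le (twoPointPlus_pos hβ x)

/-- `lim = inf` (`β > 0`): `ξ_β(x) ≤ -log ⟨σ₀σ_{nx}⟩⁺_β / n` for every `n ≥ 1`. [cite: CampaninoIoffeVelenik2003, §1.1, eq. (1.2)] -/
theorem dirInvCorrLength_le_div (hβ : 0 < β) (x : Site d) {n : ℕ} (hn : n ≠ 0) :
    dirInvCorrLength d β x ≤ -Real.log (twoPointPlus d β ((n : ℤ) • x)) / (n : ℝ) :=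
  dirInvCorrLength_le_div_of_pos hβ.le (twoPointPlus_pos hβ x) hn

/-- `lim = inf`, as an equation (`β > 0`): `ξ_β(x) = inf_{n ≥ 1} -log ⟨σ₀σ_{nx}⟩⁺_β / n`
(Mathlib's `Subadditive.lim`). [cite: CampaninoIoffeVelenik2003, §1.1, eq. (1.1)–(1.2)] -/
theorem dirInvCorrLength_eq_sInf (hβ : 0 < β) (x : Site d) :
    dirInvCorrLength d β x =
      sInf ((fun n : ℕ => -Real.log (twoPointPlus d β ((n : ℤ) • x)) / (n : ℝ)) '' Set.Ici 1) := by
  have hsub := subadditive_neg_log_twoPointPlus_zsmul hβ.le (twoPointPlus_zsmul_pos hβ x)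
  have hbdd : BddBelow (Set.range fun n : ℕ => -Real.log (twoPointPlus d β ((n : ℤ) • x)) / (n : ℝ)) :=
    ⟨0, by rintro _ ⟨n, rfl⟩; exact neg_log_twoPointPlus_zsmul_div_nonneg hβ.le x n⟩
  have heq : dirInvCorrLength d β x = hsub.lim := (hsub.tendsto_lim hbdd).liminf_eq
  rw [heq, Subadditive.lim]

/-- **The a-priori bound along a direction** (`β > 0`): `⟨σ₀σ_{nx}⟩⁺_β ≤ e^{-n ξ_β(x)}` for all
`n` (Campanino–Ioffe–Velenik 2003, eq. (1.2)). [cite: CampaninoIoffeVelenik2003, §1.1, eq. (1.2)] -/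
theorem twoPointPlus_zsmul_le_exp_neg (hβ : 0 < β) (x : Site d) (n : ℕ) :
    twoPointPlus d β ((n : ℤ) • x) ≤ Real.exp (-((n : ℝ) * dirInvCorrLength d β x)) :=
  twoPointPlus_zsmul_le_exp_neg_of_pos hβ.le (twoPointPlus_pos hβ x) n

/-- **`⟨σ₀σ_x⟩⁺_β ≤ e^{-ξ_β(x)}`** for every `β ≥ 0` and every `x` (Campanino–Ioffe–Velenik 2003,
eq. (1.2), `g_β(x) ≤ e^{-ξ_β(x)}`; trivial when `⟨σ₀σ_x⟩⁺_β = 0`). [cite: CampaninoIoffeVelenik2003, §1.1, eq. (1.2)] -/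
theorem twoPointPlus_le_exp_neg_dirInvCorrLength (hβ : 0 ≤ β) (x : Site d) :
    twoPointPlus d β x ≤ Real.exp (-dirInvCorrLength d β x) := by
  rcases (twoPointPlus_nonneg_of_gks hβ x).lt_or_eq with hx | hx
  · have h := twoPointPlus_zsmul_le_exp_neg_of_pos hβ hx 1
    simpa using h
  · rw [← hx]
    exact (Real.exp_pos _).le

/-- `ξ_β(0) = 0` (the constant sequence `-log 1 / n = 0`). [folklore] -/
theorem dirInvCorrLength_zero_right (β : ℝ) : dirInvCorrLength d β 0 = 0 := by
  simp only [dirInvCorrLength, smul_zero, twoPointPlus_zero, Real.log_one, neg_zero, zero_div,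
    liminf_const]

/-- `ξ_β(x) ≥ 0` for `β ≥ 0` (each term `-log ⟨σ₀σ_{nx}⟩⁺/n` is `≥ 0` as `⟨σ₀σ_y⟩⁺ ≤ 1`; a real
`liminf` of a nonnegative sequence is `≥ 0`, including the junk case of an unbounded sequence). [cite: CampaninoIoffeVelenik2003, §1.1] -/
theorem dirInvCorrLength_nonneg (hβ : 0 ≤ β) (x : Site d) : 0 ≤ dirInvCorrLength d β x := by
  rw [dirInvCorrLength, Filter.liminf_eq]
  set S : Set ℝ :=
    {a : ℝ | ∀ᶠ n : ℕ in atTop, a ≤ -Real.log (twoPointPlus d β ((n : ℤ) • x)) / (n : ℝ)} with hS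
  have h0 : (0 : ℝ) ∈ S :=
    Eventually.of_forall fun n => neg_log_twoPointPlus_zsmul_div_nonneg hβ x n
  by_cases hb : BddAbove S
  · exact le_csSup hb h0
  · rw [Real.sSup_of_not_bddAbove hb]

/-- **Evenness**: `ξ_β(-x) = ξ_β(x)` (from `⟨σ₀σ_{-y}⟩⁺ = ⟨σ₀σ_y⟩⁺`, translation invariance
and symmetry of the two-point function). [cite: CampaninoIoffeVelenik2003, §1.1] -/
theorem dirInvCorrLength_neg (β : ℝ) (x : Site d) :
    dirInvCorrLength d β (-x) = dirInvCorrLength d β x := by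
  simp only [dirInvCorrLength, smul_neg, twoPointPlus_neg]

/-- **Lattice symmetries**: `ξ_β` is invariant under the signed coordinate permutations of `ℤ^d`
(the hyperoctahedral group), because `⟨σ₀σ_x⟩⁺_β` is (Friedli–Velenik 2017, Exercise 3.14;
`twoPointPlus_signedPerm`). [cite: FriedliVelenik2017, Exercise 3.14, p. 115] -/
theorem dirInvCorrLength_signedPerm (β : ℝ) (π : Equiv.Perm (Fin d)) (ε : Fin d → ℤˣ)
    (x : Site d) : dirInvCorrLength d β (Site.signedPerm π ε x) = dirInvCorrLength d β x := by
  have h : ∀ n : ℕ, ((n : ℤ) • Site.signedPerm π ε x : Site d) = Site.signedPerm π ε ((n : ℤ) • x) := by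
    intro n
    funext i
    simp only [Pi.smul_apply, smul_eq_mul, Site.signedPerm_apply]
    ring
  simp only [dirInvCorrLength, h, twoPointPlus_signedPerm]

/-- In particular `ξ_β(eᵢ) = ξ_β(e₁)` for every coordinate direction. [cite: FriedliVelenik2017, Exercise 3.14, p. 115] -/
theorem dirInvCorrLength_single_one [NeZero d] (β : ℝ) (i : Fin d) :
    dirInvCorrLength d β (Pi.single i 1) = dirInvCorrLength d β (Pi.single 0 1) := by
  have h := dirInvCorrLength_signedPerm β (Equiv.swap 0 i) 1 (Pi.single 0 1)
  rw [Site.signedPerm_single] at h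
  simpa using h

/-- **Positive homogeneity**: `ξ_β(k x) = k ξ_β(x)` for `k ∈ ℕ` (`β > 0`; the defining sequence of
`k x` is `k` times a subsequence of that of `x`, which converges by Fekete). [cite: CampaninoIoffeVelenik2003, §1.1 ("homogeneous of order one")] -/
theorem dirInvCorrLength_natCast_zsmul (hβ : 0 < β) (k : ℕ) (x : Site d) :
    dirInvCorrLength d β ((k : ℤ) • x) = k * dirInvCorrLength d β x := by
  rcases Nat.eq_zero_or_pos k with rfl | hk
  · simp [dirInvCorrLength_zero_right]
  · have hseq : (fun n : ℕ => -Real.log (twoPointPlus d β ((n : ℤ) • ((k : ℤ) • x))) / (n : ℝ)) =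
        fun n : ℕ => (k : ℝ) *
          (-Real.log (twoPointPlus d β (((n * k : ℕ) : ℤ) • x)) / ((n * k : ℕ) : ℝ)) := by
      funext n
      have hsm : ((n : ℤ) • ((k : ℤ) • x) : Site d) = ((n * k : ℕ) : ℤ) • x := by
        rw [smul_smul, ← Nat.cast_mul]
      rw [hsm]
      rcases Nat.eq_zero_or_pos n with rfl | hn
      · simp
      · have hn' : (0 : ℝ) < n := by exact_mod_cast hn
        have hk' : (0 : ℝ) < k := by exact_mod_cast hk
        field_simp
        push_cast
        ring
    have hmul : Tendsto (fun n : ℕ => n * k) atTop atTop :=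
      tendsto_atTop_atTop.2 fun b => ⟨b, fun n hn => hn.trans (Nat.le_mul_of_pos_right n hk)⟩
    have htend : Tendsto (fun n : ℕ => (k : ℝ) *
        (-Real.log (twoPointPlus d β (((n * k : ℕ) : ℤ) • x)) / ((n * k : ℕ) : ℝ))) atTop
        (𝓝 ((k : ℝ) * dirInvCorrLength d β x)) :=
      ((tendsto_dirInvCorrLength hβ x).comp hmul).const_mul (k : ℝ)
    rw [dirInvCorrLength, hseq]
    exact htend.liminf_eq

/-- **Subadditivity** (`β > 0`): `ξ_β(x + y) ≤ ξ_β(x) + ξ_β(y)` — GKS II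
`⟨σ₀σ_{nx}⟩⁺⟨σ₀σ_{ny}⟩⁺ ≤ ⟨σ₀σ_{n(x+y)}⟩⁺` termwise and the existence of the three limits
(Campanino–Ioffe–Velenik 2003, §1.1: "It also follows from Griffiths' second inequality that the
function `ξ_β` is convex"). [cite: CampaninoIoffeVelenik2003, §1.1] -/
theorem dirInvCorrLength_add_le (hβ : 0 < β) (x y : Site d) :
    dirInvCorrLength d β (x + y) ≤ dirInvCorrLength d β x + dirInvCorrLength d β y := by
  refine le_of_tendsto_of_tendsto' (tendsto_dirInvCorrLength hβ (x + y))
    ((tendsto_dirInvCorrLength hβ x).add (tendsto_dirInvCorrLength hβ y)) fun n => ?_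
  have hpos := fun z => twoPointPlus_pos (d := d) hβ z
  have h := twoPointPlus_mul_le_twoPointPlus_add hβ.le ((n : ℤ) • x) ((n : ℤ) • y)
  rw [← smul_add] at h
  have hlog := Real.log_le_log (mul_pos (hpos _) (hpos _)) h
  rw [Real.log_mul (hpos _).ne' (hpos _).ne'] at hlog
  rcases Nat.eq_zero_or_pos n with rfl | hn
  · simp
  · have hn' : (0 : ℝ) < n := by exact_mod_cast hn
    rw [← add_div, div_le_div_iff_of_pos_right hn']
    linarith

/-- **The `ξ_β`-ball lies inside the sup-norm ball**: `‖x‖_∞ ξ_β(e₁) ≤ ξ_β(x)` (`β > 0`,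
`d ≥ 1`), from the Messager–Miracle-Solé comparison `⟨σ₀σ_y⟩⁺ ≤ ⟨σ₀σ_{‖y‖_∞ e₁}⟩⁺`
(`twoPointPlus_le_axis_of_mem_sphere`) applied to `y = nx`, and homogeneity. [cite: MessagerMiracleSoleJSP1977, main theorem (monotonicity of ⟨σ₀σ_x⟩ under reflections)] [cite: DuminilCopin2019, Exercise 37 (4), eq. (4.10), §4.3] -/
theorem supNorm_mul_dirInvCorrLength_axis_le [NeZero d] (hβ : 0 < β) (x : Site d) :
    (Site.supNorm x : ℝ) * dirInvCorrLength d β (Pi.single 0 1) ≤ dirInvCorrLength d β x := by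
  have hd : 1 ≤ d := Nat.one_le_iff_ne_zero.2 (NeZero.ne d)
  have h0 : (⟨0, hd⟩ : Fin d) = 0 := Fin.ext (by simp)
  have hMMS : ∀ {β : ℝ}, messager_miracleSole (d := d) (β := β) := fun {β} =>
    messager_miracleSole_holds (d := d) (β := β)
  -- `‖n x‖_∞ e₁ = n (‖x‖_∞ e₁)`
  have hsm : ∀ n : ℕ, (Pi.single 0 ((Site.supNorm ((n : ℤ) • x) : ℕ) : ℤ) : Site d) =
      (n : ℤ) • ((Site.supNorm x : ℤ) • Pi.single (0 : Fin d) (1 : ℤ)) := by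
    intro n
    have hnorm : (Site.supNorm ((n : ℤ) • x) : ℝ) = n * Site.supNorm x := by
      rw [← Site.norm_eq_supNorm, Site.norm_natCast_zsmul, Site.norm_eq_supNorm]
    have hnat : Site.supNorm ((n : ℤ) • x) = n * Site.supNorm x := by exact_mod_cast hnorm
    rw [hnat, smul_smul]
    ext j
    by_cases hj : j = 0
    · subst hj; simp
    · simp [Pi.single_eq_of_ne hj]
  rw [← dirInvCorrLength_natCast_zsmul hβ (Site.supNorm x) (Pi.single 0 1)]
  refine le_of_tendsto_of_tendsto' (tendsto_dirInvCorrLength hβ _) (tendsto_dirInvCorrLength hβ x)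
    fun n => ?_
  refine div_le_div_of_nonneg_right ?_ (Nat.cast_nonneg n)
  rw [neg_le_neg_iff]
  refine Real.log_le_log (twoPointPlus_pos hβ _) ?_
  have h := twoPointPlus_le_axis_of_mem_sphere hMMS twoPointPlus_reflection_invariant_holds
    twoPointPlus_perm_invariant_holds hβ.le hd (self_mem_sphere ((n : ℤ) • x))
  rwa [h0, hsm n] at h

/-- **The `ξ_β`-ball contains the `ℓ¹`-ball**: `ξ_β(x) ≤ ‖x‖₁ ξ_β(e₁)` (`β > 0`, `d ≥ 1`), from
subadditivity over `x = ∑ᵢ xᵢ eᵢ`, homogeneity, evenness and `ξ_β(eᵢ) = ξ_β(e₁)`. Together with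
`supNorm_mul_dirInvCorrLength_axis_le` this is the Messager–Miracle-Solé window
`‖x‖_∞ ≤ ξ_β(x)/ξ_β(e₁) ≤ ‖x‖₁` (octahedron ⊆ unit ball ⊆ cube). [cite: MessagerMiracleSoleJSP1977, main theorem] [cite: CampaninoIoffeVelenik2003, §1.1] -/
theorem dirInvCorrLength_le_l1Norm_mul_axis [NeZero d] (hβ : 0 < β) (x : Site d) :
    dirInvCorrLength d β x ≤ (∑ i, ((x i).natAbs : ℝ)) * dirInvCorrLength d β (Pi.single 0 1) := by
  -- one coordinate: `ξ(xᵢ eᵢ) = |xᵢ| ξ(e₁)`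
  have hcoord : ∀ i : Fin d, dirInvCorrLength d β (Pi.single i (x i)) =
      ((x i).natAbs : ℝ) * dirInvCorrLength d β (Pi.single 0 1) := by
    intro i
    rw [← dirInvCorrLength_single_one β i]
    have hsm : ∀ m : ℕ, (Pi.single i (m : ℤ) : Site d) = (m : ℤ) • Pi.single i (1 : ℤ) := by
      intro m
      ext j
      by_cases hj : j = i
      · subst hj; simp
      · simp [Pi.single_eq_of_ne hj]
    obtain ⟨m, hm | hm⟩ := Int.eq_nat_or_neg (x i)
    · rw [hm, hsm m, dirInvCorrLength_natCast_zsmul hβ, Int.natAbs_natCast]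
    · rw [hm, Pi.single_neg, dirInvCorrLength_neg, hsm m, dirInvCorrLength_natCast_zsmul hβ,
        Int.natAbs_neg, Int.natAbs_natCast]
  -- subadditivity over the coordinate decomposition
  have key : ∀ s : Finset (Fin d), dirInvCorrLength d β (∑ i ∈ s, Pi.single i (x i)) ≤
      ∑ i ∈ s, dirInvCorrLength d β (Pi.single i (x i)) := by
    intro s
    refine Finset.induction_on s ?_ ?_
    · simp [dirInvCorrLength_zero_right]
    · intro j s hj ih
      rw [Finset.sum_insert hj, Finset.sum_insert hj]
      exact (dirInvCorrLength_add_le hβ _ _).trans (by linarith)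
  have h := key Finset.univ
  rw [Finset.univ_sum_single x] at h
  refine h.trans (le_of_eq ?_)
  rw [Finset.sum_mul]
  exact Finset.sum_congr rfl fun i _ => hcoord i

end NormPackage

/-! ### Part 3. Dependence on `β`: monotonicity, positivity below `β_c`, vanishing at `β_c` -/

section Beta

variable {d : ℕ} {β : ℝ}

/-- **`β ↦ ξ_β(x)` is non-increasing on `β > 0`** (the two-point function is nondecreasing in `β`
by GKS II, `twoPointPlus_le_twoPointPlus_of_le`; compare the limits). [cite: FriedliVelenik2017, Lemma 3.31, p. 119] -/
theorem dirInvCorrLength_anti (hβ : 0 < β) {β' : ℝ} (hββ' : β ≤ β') (x : Site d) :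
    dirInvCorrLength d β' x ≤ dirInvCorrLength d β x := by
  have hβ' : 0 < β' := hβ.trans_le hββ'
  refine le_of_tendsto_of_tendsto' (tendsto_dirInvCorrLength hβ' x) (tendsto_dirInvCorrLength hβ x)
    fun n => ?_
  refine div_le_div_of_nonneg_right ?_ (Nat.cast_nonneg n)
  rw [neg_le_neg_iff]
  exact Real.log_le_log (twoPointPlus_pos hβ _) (twoPointPlus_le_twoPointPlus_of_le hβ.le hββ' _)

/-- `β ↦ ξ_β(x)` is antitone on `(0, ∞)`. [cite: FriedliVelenik2017, Lemma 3.31, p. 119] -/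
theorem dirInvCorrLength_antitoneOn (x : Site d) :
    AntitoneOn (fun β : ℝ => dirInvCorrLength d β x) (Set.Ioi 0) :=
  fun _ hβ _ _ hββ' => dirInvCorrLength_anti hβ hββ' x

/-- **`ξ_β` is an equivalent norm below `β_c`: the lower bound.** For `d ≥ 2` and
`0 < β < β_c(d)` there is `c > 0` with `c ‖x‖_∞ ≤ ξ_β(x)` for all `x` — from the sharpness of
the phase transition `⟨σ₀σ_x⟩^∅_β ≤ e^{-c‖x‖_∞}` (Aizenman–Barsky–Fernández 1987, Thm. 1;
`twoPoint_exponentialDecay_of_lt_criticalBeta_holds`) and `⟨·⟩⁺_β = ⟨·⟩^∅_β` below `β_c`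
(`m*(β) = 0`, Lebowitz–Martin-Löf); Campanino–Ioffe–Velenik 2003, Thm. 1.1 ("`ξ_β > 0` iff
`β < β_c`", the "if" direction). [cite: CampaninoIoffeVelenik2003, Thm. 1.1] [cite: AizenmanBarskyFernandezJSP1987, Thm. 1] -/
theorem exists_mul_norm_le_dirInvCorrLength (hd : 2 ≤ d) (hβ : 0 < β) (hβc : β < criticalBeta d) :
    ∃ c : ℝ, 0 < c ∧ ∀ x : Site d, c * ‖x‖ ≤ dirInvCorrLength d β x := by
  obtain ⟨c, hc, hdec⟩ := twoPoint_exponentialDecay_of_lt_criticalBeta_holds (d := d) hd hβ.le hβc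
  have hm : spontaneousMagnetization d β = 0 :=
    spontaneousMagnetization_eq_zero_of_lt_criticalBeta_holds hβ.le hβc
  have hplus : ∀ y : Site d, twoPointPlus d β y ≤ Real.exp (-c * ‖y‖) := fun y => by
    rw [← twoPointFree_eq_twoPointPlus_of_spontaneousMagnetization_eq_zero hβ.le hm y]
    exact hdec y
  refine ⟨c, hc, fun x => ?_⟩
  refine ge_of_tendsto (tendsto_dirInvCorrLength hβ x) (eventually_atTop.2 ⟨1, fun n hn => ?_⟩)
  have hn' : (0 : ℝ) < n := by exact_mod_cast hn
  rw [le_div_iff₀ hn']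
  have h1 := Real.log_le_log (twoPointPlus_pos hβ _) (hplus ((n : ℤ) • x))
  rw [Real.log_exp, Site.norm_natCast_zsmul] at h1
  linarith

/-- **Positivity of the directional inverse correlation length below `β_c`**: for `d ≥ 2`,
`0 < β < β_c(d)` and `x ≠ 0`, `ξ_β(x) > 0` (Campanino–Ioffe–Velenik 2003, Thm. 1.1, from
Aizenman–Barsky–Fernández sharpness). [cite: CampaninoIoffeVelenik2003, Thm. 1.1] [cite: AizenmanBarskyFernandezJSP1987, Thm. 1] -/
theorem dirInvCorrLength_pos (hd : 2 ≤ d) (hβ : 0 < β) (hβc : β < criticalBeta d) {x : Site d}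
    (hx : x ≠ 0) : 0 < dirInvCorrLength d β x := by
  obtain ⟨c, hc, h⟩ := exists_mul_norm_le_dirInvCorrLength hd hβ hβc
  exact (mul_pos hc (norm_pos_iff.2 hx)).trans_le (h x)

/-- **The directional inverse correlation length vanishes at `β_c`** (`d ≥ 2`, every direction):
from the polynomial lower bound `⟨σ₀σ_x⟩⁺_{β_c} ≥ c ‖x‖_∞^{-(d-1)}` (`criticalTwoPoint_lower`,
Simon 1980 / Duminil-Copin 2019, Thm. 4.8), `-log ⟨σ₀σ_{nx}⟩⁺_{β_c}/n ≤ (-log c + (d-1) log(n‖x‖_∞))/n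
→ 0`; Campanino–Ioffe–Velenik 2003, Thm. 1.1 ("only if" at `β = β_c`). [cite: CampaninoIoffeVelenik2003, Thm. 1.1] [cite: DuminilCopin2019, Thm. 4.8, §4.4] -/
theorem dirInvCorrLength_criticalBeta (hd : 2 ≤ d) (x : Site d) :
    dirInvCorrLength d (criticalBeta d) x = 0 := by
  by_cases hx : x = 0
  · subst hx
    exact dirInvCorrLength_zero_right _
  have hβc : 0 < criticalBeta d := criticalBeta_pos_holds hd
  obtain ⟨c, hc, hlow⟩ := criticalTwoPoint_lower (d := d) hd
  refine le_antisymm ?_ (dirInvCorrLength_nonneg hβc.le x)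
  have hx' : 0 < ‖x‖ := norm_pos_iff.2 hx
  -- the comparison sequence `g n = (-log c + (d-1) log ‖x‖)/n + (d-1) log n / n → 0`
  set A : ℝ := -Real.log c + ((d : ℝ) - 1) * Real.log ‖x‖ with hA
  have hlog : Tendsto (fun n : ℕ => Real.log (n : ℝ) / (n : ℝ)) atTop (𝓝 0) := by
    have h := (Real.isLittleO_log_id_atTop.tendsto_div_nhds_zero).comp tendsto_natCast_atTop_atTop
    simpa [Function.comp_def] using h
  have hg : Tendsto (fun n : ℕ => A / (n : ℝ) + ((d : ℝ) - 1) * (Real.log (n : ℝ) / (n : ℝ)))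
      atTop (𝓝 0) := by
    have h := (tendsto_const_div_atTop_nhds_zero_nat A).add (hlog.const_mul ((d : ℝ) - 1))
    simpa using h
  refine ge_of_tendsto hg ?_
  filter_upwards [eventually_ge_atTop 1] with n hn
  have hn' : (0 : ℝ) < n := by exact_mod_cast hn
  have hnx : ((n : ℤ) • x : Site d) ≠ 0 := by
    rw [← norm_pos_iff, Site.norm_natCast_zsmul]
    exact mul_pos hn' hx'
  have h := hlow ((n : ℤ) • x) hnx
  rw [Site.norm_natCast_zsmul, criticalTwoPoint] at h
  have hpos : 0 < (n : ℝ) * ‖x‖ := mul_pos hn' hx'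
  have hrp : 0 < ((n : ℝ) * ‖x‖) ^ (-((d : ℝ) - 1)) := Real.rpow_pos_of_pos hpos _
  have hl := Real.log_le_log (mul_pos hc hrp) h
  rw [Real.log_mul hc.ne' hrp.ne', Real.log_rpow hpos, Real.log_mul hn'.ne' hx'.ne'] at hl
  calc dirInvCorrLength d (criticalBeta d) x
      ≤ -Real.log (twoPointPlus d (criticalBeta d) ((n : ℤ) • x)) / (n : ℝ) :=
        dirInvCorrLength_le_div hβc x (by omega)
    _ ≤ (A + ((d : ℝ) - 1) * Real.log (n : ℝ)) / (n : ℝ) := by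
        refine div_le_div_of_nonneg_right ?_ hn'.le
        rw [hA]
        linarith
    _ = A / (n : ℝ) + ((d : ℝ) - 1) * (Real.log (n : ℝ) / (n : ℝ)) := by ring

end Beta

/-! ### Part 4. The axis direction: agreement with `invCorrLength` -/

section Axis

variable {d : ℕ} {β : ℝ}

/-- Along `e₁` the directional inverse correlation length is the tree's axis quantity
`invCorrLength (twoPointPlus d β) = liminf -log |⟨σ₀σ_{ne₁}⟩⁺| / n` (`β ≥ 0`, so that
`|⟨σ₀σ_y⟩⁺| = ⟨σ₀σ_y⟩⁺`; Friedli–Velenik 2017, §3.10.11, p. 173). [cite: FriedliVelenik2017, §3.10.11, p. 173] -/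
theorem dirInvCorrLength_single_zero_one [NeZero d] (hβ : 0 ≤ β) :
    dirInvCorrLength d β (Pi.single 0 1) = invCorrLength (twoPointPlus d β) := by
  unfold dirInvCorrLength invCorrLength
  congr 1
  funext n
  rw [abs_of_nonneg (twoPointPlus_nonneg_of_gks hβ _)]

/-- Hence the tree's Ising correlation length is `ξ(β) = ξ_β(e₁)⁻¹` (`β ≥ 0`). [cite: FriedliVelenik2017, §3.10.11, p. 173] -/
theorem isingCorrLength_eq_inv_dirInvCorrLength [NeZero d] (hβ : 0 ≤ β) :
    isingCorrLength d β = (dirInvCorrLength d β (Pi.single 0 1))⁻¹ := by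
  rw [isingCorrLength, corrLength, dirInvCorrLength_single_zero_one hβ]

/-- The axis inverse correlation length is a genuine limit for `β > 0`:
`HasInvCorrLength (twoPointPlus d β) (invCorrLength (twoPointPlus d β))` (Fekete; Friedli–Velenik
2017, §3.10.11). [cite: FriedliVelenik2017, §3.10.11, p. 173] -/
theorem hasInvCorrLength_twoPointPlus [NeZero d] (hβ : 0 < β) :
    HasInvCorrLength (twoPointPlus d β) (invCorrLength (twoPointPlus d β)) := by
  rw [← dirInvCorrLength_single_zero_one hβ.le]
  unfold HasInvCorrLength
  have h := tendsto_dirInvCorrLength hβ (Pi.single (0 : Fin d) (1 : ℤ))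
  refine h.congr fun n => ?_
  rw [abs_of_nonneg (twoPointPlus_nonneg_of_gks hβ.le _)]

end Axis

end Literature.Probability.LatticeModels
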